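import Summits.AtomisticToContinuum.HydrodynamicLimit.Theses.LambertianContactSwap
import Summits.AtomisticToContinuum.HydrodynamicLimit.Theorems.LambertianContactSwapSwapGapStubFieldConcentrationStatic
import Summits.AtomisticToContinuum.HydrodynamicLimit.Theorems.LambertianContactSwapLambertianEulerLiouville
import Summits.AtomisticToContinuum.HydrodynamicLimit.Theorems.LambertianContactSwapSwapGapEntropyTransfer
import Literature.MathematicalPhysics.KineticTheory.LambertianHardSphereFlow
import HarnessLib

/-!
# `SwapGap` (stmt-AtomisticToContinuum-11850), line `Sketch`: rung R2 — S2 HOLDS on the equilibrium rung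

Helper file (`--supports stmt-AtomisticToContinuum-11850`) of line `Sketch` (card
`entropy-relative-to-lambertian-law`) for the crux
`Summit.AtomisticToContinuum.HydrodynamicLimit.Theses.LambertianContactSwap.SwapGap`, registered helper
stub `stub_fieldConcentration_equilibrium` (rung R2) of the lead's skeleton: for CONSTANT profiles
`a, θ > 0`, `u` and `0 < σ < σ₀`, every `1`-Lipschitz statistic `F` bounded by `1` of the `χ`-tested
field triple `(density, momentum, energy)` of the Lambertian flow `Λ_t` concentrates exponentially
(speed `N + 1`) around its own mean under `G_N ⊗ γ^ℕ`, uniformly in `N`, in the hard-sphere flow `Φ`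
and in `t ≥ 0`, where `G_N = localGibbsLaw σ (fun _ => a) (fun _ => u) (fun _ => θ) N Φ` is the
homogeneous Gibbs law. So the research stub S2 of the line is a theorem on the equilibrium rung.

Proof. The law of `Λ_t` under `G_N ⊗ γ^ℕ` is `G_N` itself (`gibbsInvarianceLambda_holds`, for
`0 < σ < 1/2`, `t ≥ 0`), so both the mean (`integral_map`) and the deviation event (`Measure.map_apply`,
the flow is jointly measurable by `measurable_lambertFlow_hsDiameter` and the statistic is measurable by
`measurable_fieldTriple`) are the STATIC ones of rung R0, `stub_fieldConcentration_static`, applied to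
the constant profiles; its threshold `σ₁` is cut to `σ₀ := min (1/2) σ₁` and its constant `C` (uniform
in `N, Φ`) is the constant here.

prover-line-stmt-AtomisticToContinuum-11850-c3-0, wave 6.
-/

noncomputable section

open MeasureTheory Filter Set Topology
open scoped ENNReal

namespace Summit.AtomisticToContinuum.HydrodynamicLimit.Theorems

open Literature.Analysis.FluidPDE Literature.MathematicalPhysics.KineticTheory

/-- **R2 · EQUILIBRIUM RUNG OF S2.** For constant profiles `a, θ > 0`, `u` there is `σ₀ > 0` such that
for `0 < σ < σ₀`, every continuous `χ`, every `1`-Lipschitz `F` bounded by `1` and every `δ > 0` there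
is `C > 0` with `(G_N ⊗ γ^ℕ){δ < |F(fld(Λ_t, χ)) − ∫ F(fld(Λ_t, χ)) d(G_N ⊗ γ^ℕ)|} ≤ C e^{−(N+1)/C}`
for ALL `N`, ALL flows `Φ` and ALL `t ≥ 0`, where `G_N = localGibbsLaw σ a u θ N Φ` is the homogeneous
Gibbs law: the law of `Λ_t` under `G_N ⊗ γ^ℕ` is `G_N` (`gibbsInvarianceLambda_holds`), so the
deviation probability and the mean are the static ones of `stub_fieldConcentration_static` (rung R0).
[folklore] -/
theorem stub_fieldConcentration_equilibrium :
    ∀ (a θ : ℝ) (u : V3), 0 < a → 0 < θ → ∃ σ₀ : ℝ, 0 < σ₀ ∧ ∀ σ : ℝ, 0 < σ → σ < σ₀ →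
      ∀ χ : T3 → ℝ, Continuous χ → ∀ F : ℝ × V3 × ℝ → ℝ, LipschitzWith 1 F → (∀ y, |F y| ≤ 1) →
        ∀ δ : ℝ, 0 < δ → ∃ C : ℝ, 0 < C ∧
          ∀ (N : ℕ) (Φ : HardSphereFlow (Torus.geometry (Fin 3)) (hsDiameter σ N) (N + 1)) (t : ℝ), 0 ≤ t →
            ((localGibbsLaw σ (fun _ => a) (fun _ => u) (fun _ => θ) N Φ).prod (lambertNoise (Fin 3)))
                {p | δ < |F (empiricalDensityField
                        (lambertFlow (Torus.geometry (Fin 3)) (hsDiameter σ N) p.2 p.1 t) χ,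
                      empiricalMomentumField
                        (lambertFlow (Torus.geometry (Fin 3)) (hsDiameter σ N) p.2 p.1 t) χ,
                      empiricalEnergyField
                        (lambertFlow (Torus.geometry (Fin 3)) (hsDiameter σ N) p.2 p.1 t) χ) -
                    ∫ q, F (empiricalDensityField
                        (lambertFlow (Torus.geometry (Fin 3)) (hsDiameter σ N) q.2 q.1 t) χ,
                      empiricalMomentumField
                        (lambertFlow (Torus.geometry (Fin 3)) (hsDiameter σ N) q.2 q.1 t) χ,
                      empiricalEnergyField
                        (lambertFlow (Torus.geometry (Fin 3)) (hsDiameter σ N) q.2 q.1 t) χ)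
                      ∂((localGibbsLaw σ (fun _ => a) (fun _ => u) (fun _ => θ) N Φ).prod
                          (lambertNoise (Fin 3)))|} ≤
              ENNReal.ofReal (C * Real.exp (-(C⁻¹ * ((N : ℝ) + 1)))) := by
  intro a θ u ha hθ
  -- rung R0 for the constant profiles
  obtain ⟨σ₁, hσ₁, hstat⟩ := stub_fieldConcentration_static (fun _ => a) (fun _ => θ) (fun _ => u)
    continuous_const continuous_const continuous_const (fun _ => ha) (fun _ => hθ)
  refine ⟨min 2⁻¹ σ₁, lt_min (by norm_num) hσ₁, ?_⟩
  intro σ hσ hσlt χ hχ F hF hF1 δ hδ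
  have hσhalf : σ < 2⁻¹ := hσlt.trans_le (min_le_left _ _)
  have hσσ₁ : σ < σ₁ := hσlt.trans_le (min_le_right _ _)
  obtain ⟨C, hC, hCN⟩ := hstat σ hσ hσσ₁ χ hχ F hF hF1 δ hδ
  refine ⟨C, hC, fun N Φ t ht => ?_⟩
  -- notation: the Gibbs law `G`, the Lambertian flow `Λ` at time `t`, the tested field triple `T`
  set G : Measure (Config (N + 1) (Fin 3) T3) :=
    localGibbsLaw σ (fun _ => a) (fun _ => u) (fun _ => θ) N Φ
  set Λ : Config (N + 1) (Fin 3) T3 × (ℕ → V3) → Config (N + 1) (Fin 3) T3 :=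
    fun p => lambertFlow (Torus.geometry (Fin 3)) (hsDiameter σ N) p.2 p.1 t
  set T : Config (N + 1) (Fin 3) T3 → ℝ × V3 × ℝ :=
    fun z => (empiricalDensityField z χ, empiricalMomentumField z χ, empiricalEnergyField z χ)
  have hΛ : Measurable Λ := measurable_lambertFlow_hsDiameter hσ.le hσhalf N t
  have hT : Measurable T := measurable_fieldTriple hχ
  have hFT : Measurable fun z => F (T z) := hF.continuous.measurable.comp hT
  -- the law of `Λ_t` under `G ⊗ γ^ℕ` is `G`
  have hinv : (G.prod (lambertNoise (Fin 3))).map Λ = G :=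
    LambertianContactSwapLambertianEulerLiouville.gibbsInvarianceLambda_holds σ hσ hσhalf N a θ u
      ha hθ Φ t ht
  -- (i) the mean is the static mean
  have hmean : ∫ q, F (T (Λ q)) ∂(G.prod (lambertNoise (Fin 3))) = ∫ z, F (T z) ∂G := by
    rw [← integral_map hΛ.aemeasurable hFT.aestronglyMeasurable, hinv]
  -- (ii) the deviation event has the static probability
  have hAm : MeasurableSet {z | δ < |F (T z) - ∫ w, F (T w) ∂G|} :=
    measurableSet_lt measurable_const (hFT.sub measurable_const).abs
  have hev : (G.prod (lambertNoise (Fin 3)))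
        {p | δ < |F (T (Λ p)) - ∫ q, F (T (Λ q)) ∂(G.prod (lambertNoise (Fin 3)))|} =
      G {z | δ < |F (T z) - ∫ w, F (T w) ∂G|} := by
    rw [hmean]
    calc (G.prod (lambertNoise (Fin 3))) {p | δ < |F (T (Λ p)) - ∫ w, F (T w) ∂G|}
        = ((G.prod (lambertNoise (Fin 3))).map Λ) {z | δ < |F (T z) - ∫ w, F (T w) ∂G|} :=
          (Measure.map_apply hΛ hAm).symm
      _ = G {z | δ < |F (T z) - ∫ w, F (T w) ∂G|} := by rw [hinv]
  have key : (G.prod (lambertNoise (Fin 3)))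
        {p | δ < |F (T (Λ p)) - ∫ q, F (T (Λ q)) ∂(G.prod (lambertNoise (Fin 3)))|} ≤
      ENNReal.ofReal (C * Real.exp (-(C⁻¹ * ((N : ℝ) + 1)))) := by
    rw [hev]
    exact hCN N Φ
  exact key

end Summit.AtomisticToContinuum.HydrodynamicLimit.Theorems
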